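import Literature.NumberTheory.Sieve.PolymathBoundedGapsM50OrbitalTI1
import Literature.NumberTheory.Sieve.PolymathBoundedGapsM50OrbitalTI2
import Literature.NumberTheory.Sieve.PolymathBoundedGapsM50OrbitalTI3
import Literature.NumberTheory.Sieve.PolymathBoundedGapsM50OrbitalTI4
import Literature.NumberTheory.Sieve.PolymathBoundedGapsM50OrbitalTI5
import Literature.NumberTheory.Sieve.PolymathBoundedGapsM50OrbitalTJ1
import Literature.NumberTheory.Sieve.PolymathBoundedGapsM50OrbitalTJ2
import Literature.NumberTheory.Sieve.PolymathBoundedGapsM50OrbitalTJ3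
import Literature.NumberTheory.Sieve.PolymathBoundedGapsM50OrbitalTJ4
import Literature.NumberTheory.Sieve.PolymathBoundedGapsM50OrbitalTJ5
import HarnessLib

/-!
# `M_{50,1/27} > 4`, kernel-pure — the table dispatch `tI`, `tJ`

Part of the kernel-pure certificate **`M_{50,1/27} > 4`** (parity-ideate cell, ROUND-24 «ALS-ORBITAL», certificate E1 T_3 =
`ALS_r3_cert.json`, sha16 d9bc336f5c4ec53f, λ = 4.000110928047049…, independently verified by the cell's `verify_indep.py` and
reproduced EXACTLY by the Literature mirror `symcert/mirror.py`): a labelled product-radial test function on `(1+ε)·R_50`,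
`ε = 1/27`, base profile `g` (degree 6) and three orbitals `o1, o2, o3` (degree ≤ 19, dyadic, common scale `2^-50`), eleven
excitation multisets `∅, o1, o2, o3, o1o1, o1o2, o1o3, o2o2, o2o3, o3o3, o1o1o1` with integer radial polynomials of degree ≤ 14.
Checked by `SymLCert.sound_tab` (`PolymathSymLCert.lean`): files `PolymathBoundedGapsM50OrbitalCert` (data), `PolymathBoundedGapsM50OrbitalTI1…TI5/TJ1…TJ5` (the
claimed pair numerators), `PolymathBoundedGapsM50OrbitalTables` (dispatch), `PolymathBoundedGapsM50OrbitalPairs1…` (one `decide +kernel` per lower-triangle pair),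
`PolymathBoundedGapsM50OrbitalMain` (assembly: `exists_polymathFunctional_50_gt_four`, standard axioms — no `Lean.ofReduceBool`).

## References
* D. H. J. Polymath, *Variants of the Selberg sieve, and bounded intervals containing many primes*, Res. Math. Sci. 1 (2014),
  Art. 12 = arXiv:1407.4897: Theorem 3.13 / eq. (35) (numerical lower bounds for `M_{k,ε}`), §7 (the test-function algebra),
  Theorem 1.4(i) (`H₁ ≤ 246` from `M_{50,ε} > 4`). [Polymath8b2014]
-/

namespace Literature.NumberTheory.Sieve.PolymathCert

namespace PolymathM50Orbital

/-- the claimed `I`-side pair numerators `tI x y` (`y ≤ x < 11`; rows 0–4 / 5 / 6–7 / 8–9 / 10 in `tI1 / tI5 / tI2 / tI3 / tI4`). [cite: Polymath8b2014, Theorem 3.13, eq. (35)] -/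
def tI (x y : ℕ) : ℤ :=
  if x ≤ 4 then tI1 x y else if x ≤ 5 then tI5 x y else if x ≤ 7 then tI2 x y else if x ≤ 9 then tI3 x y else tI4 x y

/-- the claimed `J`-side pair numerators `tJ a b` (`b ≤ a < 11`; same row blocks). [cite: Polymath8b2014, Theorem 3.13, eq. (35)] -/
def tJ (a b : ℕ) : ℤ :=
  if a ≤ 4 then tJ1 a b else if a ≤ 5 then tJ5 a b else if a ≤ 7 then tJ2 a b else if a ≤ 9 then tJ3 a b else tJ4 a b

end PolymathM50Orbital

end Literature.NumberTheory.Sieve.PolymathCert
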